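import Mathlib
import Summits.AtomisticToContinuum.Crystallization.Theses.PhononSlackCertificates
import Summits.AtomisticToContinuum.Crystallization.Theorems.PhononSlackCertificatesNearFarGlueRHcpBoxShell
import Summits.AtomisticToContinuum.Crystallization.Theorems.ChargedEnergyGap.Negative.BlocksBound
import Summits.AtomisticToContinuum.Crystallization.Theorems.NearFarGlueR.Negative.GlueToolkit
import Summits.AtomisticToContinuum.Crystallization.Theorems.OneCentreSteepnessLadderDominationEnergyLimitHcp
import Literature.MathematicalPhysics.StatisticalMechanics.PeriodicConfigurationSums
import Literature.MathematicalPhysics.StatisticalMechanics.LennardJonesClusters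
import Literature.MathematicalPhysics.StatisticalMechanics.CrystallizationSymmetries
import Literature.MathematicalPhysics.StatisticalMechanics.BarlowCoordination
import Literature.MathematicalPhysics.StatisticalMechanics.HcpHomogeneous
import Literature.Geometry.DiscreteGeometry.TwoShellPatterns

/-!
# Crux `PhononSlackCertificates.NearFarGlueR` (stmt-AtomisticToContinuum-14970), line `Sketch`:
the target (hence the residual) HOLDS on sub-configurations of the RELAXED hexagonal close packing

Continuation lead c2; part 2 of 2 of the box version (part 1:
`PhononSlackCertificatesNearFarGlueRHcpBoxShell.lean`; ideal version `…HcpSubset.lean`).  For every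
finite set of distinct particles `x` drawn from the stacking `hcpStacking a h` with in-layer
spacing `a ∈ [47/50, 1]` and ANY interlayer spacing in the route's box `h ∈ [39a/50, 17a/20]` —
so for the conjectured Lennard-Jones ground state with its relaxed, non-ideal axial ratio, minus
vacancies, vacancy clusters, voids, with free surfaces, finite pieces of ANY shape —

  `N · e* + (1/150) · #{i : particle i is not 1/20-good} ≤ 𝓔_LJ(x)`   (`hcpBoxSubsetGap`),

i.e. the route's TARGET `CoerciveTwoShellGap` (a fortiori `TightContactGap`, `ContactGap`,
`FarFieldGapR`, `AllBadGap`) on this class.  Mechanism as in the ideal case: `e* ≤ e(hcp_{a,h})`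
(`eStar_le` — the only use of `e*`); vertex-transitivity (`hcpStacking_homogeneous`) transports the
site sum of the origin (`energyPerParticle_hcp_eq_half_tsum`) to every particle; the relaxed
stacking is `24a/25 ≥ 9/10`-separated (`le_dist_of_mem_hcpStacking_box`), so every vacant term is
`≤ 0` (`lennardJones_nonpos_of_ge_nine_tenths`); a bad particle owns a vacant stacking site within
`(1/20 + √2)·a ≤ 147/100` (part 1, `exists_vacant_site_of_bad_hcp_box`), worth `≤ −1/75`
(`lennardJones_le_of_mem_range`).  Registered sub-goal `stub_hcpBoxSubset` of the crux item.
Corollary for the hull / torus arguments: every point of the relaxed (or ideal) hcp stacking is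
`1/20`-good IN the stacking, `isTwoShellGoodSet_hcpStacking_box / _ideal`.
-/

noncomputable section

namespace Summit.AtomisticToContinuum.Crystallization.Theorems.PhononSlackCertificatesNearFarGlueR

open Literature.MathematicalPhysics.StatisticalMechanics
open Literature.Geometry.DiscreteGeometry
open Summit.AtomisticToContinuum.Crystallization.Theses.PhononSlackCertificates
open Summit.AtomisticToContinuum.Crystallization.Theorems.ChargedEnergyGapNegative (eStar_le)
open Summit.AtomisticToContinuum.Crystallization.Theorems.NearFarGlueRNegative (sum_halfSite_sub_eStar)
open Summit.AtomisticToContinuum.Crystallization.Theorems.DominationEnergyLimit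
  (energyPerParticle_hcp_eq_half_tsum tsum_ne_zero_eq_tsum)
open scoped BigOperators

/-! ## §9 Lennard-Jones values on the relaxed two shells -/

/-- `V_LJ(r) ≤ 0` for `r ≥ 9/10` (indeed for `r ≥ 2^{-1/6} ≈ 0.891`): every missing bond of the
relaxed stacking was attractive. [folklore] -/
theorem lennardJones_nonpos_of_ge_nine_tenths {r : ℝ} (hr : 9 / 10 ≤ r) : lennardJones r ≤ 0 := by
  unfold lennardJones
  have h0 : 0 < r := by linarith
  have hinv : r⁻¹ ≤ (9 / 10 : ℝ)⁻¹ := inv_anti₀ (by norm_num) hr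
  have hinv0 : 0 ≤ r⁻¹ := inv_nonneg.2 h0.le
  have ht : (r⁻¹) ^ 6 ≤ ((9 / 10 : ℝ)⁻¹) ^ 6 := pow_le_pow_left₀ hinv0 hinv 6
  have h2 : ((9 / 10 : ℝ)⁻¹) ^ 6 < 2 := by norm_num
  have ht0 : 0 ≤ (r⁻¹) ^ 6 := by positivity
  have h12 : (r⁻¹) ^ 12 = ((r⁻¹) ^ 6) ^ 2 := by ring
  rw [h12]
  nlinarith

/-- **A missing relaxed two-shell bond is worth at least `1/75`**: `V_LJ(r) ≤ −1/75` for
`r ∈ [9/10, 147/100]` (with `u = r⁻⁶ ∈ [0.099, 1.882]`, `V = u²/12 − u/6` and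
`75u² − 150u + 12 ≤ 0` on `[0.084, 1.916]`). [folklore] -/
theorem lennardJones_le_of_mem_range {r : ℝ} (h1 : 9 / 10 ≤ r) (h2 : r ≤ 147 / 100) :
    lennardJones r ≤ -(1 / 75) := by
  unfold lennardJones
  have h0 : 0 < r := by linarith
  have hinv : r⁻¹ ≤ (9 / 10 : ℝ)⁻¹ := inv_anti₀ (by norm_num) h1
  have hinv' : (147 / 100 : ℝ)⁻¹ ≤ r⁻¹ := inv_anti₀ h0 h2
  have hinv0 : 0 ≤ r⁻¹ := inv_nonneg.2 h0.le
  set u : ℝ := (r⁻¹) ^ 6 with hu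
  have hup : u ≤ ((9 / 10 : ℝ)⁻¹) ^ 6 := pow_le_pow_left₀ hinv0 hinv 6
  have hlo : ((147 / 100 : ℝ)⁻¹) ^ 6 ≤ u := pow_le_pow_left₀ (by norm_num) hinv' 6
  have hup' : ((9 / 10 : ℝ)⁻¹) ^ 6 ≤ 1.89 := by norm_num
  have hlo' : (0.099 : ℝ) ≤ ((147 / 100 : ℝ)⁻¹) ^ 6 := by norm_num
  have h12 : (r⁻¹) ^ 12 = u ^ 2 := by rw [hu]; ring
  rw [h12]
  nlinarith [mul_nonneg (sub_nonneg.2 (hlo'.trans hlo)) (sub_nonneg.2 (hup.trans hup'))]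

/-- `√2 ≤ 1.4143`. [folklore] -/
theorem sqrt_two_le : Real.sqrt 2 ≤ 1.4143 := by
  rw [show (1.4143 : ℝ) = Real.sqrt (1.4143 ^ 2) from (Real.sqrt_sq (by norm_num)).symm]
  exact Real.sqrt_le_sqrt (by norm_num)

/-! ## §10 The site-sum identity on the relaxed hcp stacking and the gap -/

/-- **The target on relaxed hcp sub-configurations** (registered sub-goal `stub_hcpBoxSubset` of
the crux item, theorem form).  For distinct particles on `hcpStacking a h`, `a ∈ [47/50, 1]`,
`h ∈ [39a/50, 17a/20]`: `N · e* + (1/150) · #bad ≤ 𝓔_LJ(x)`.  Proof: `e* ≤ e(hcp_{a,h})`; for every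
particle `½ Σ_{j≠i} V = e(hcp_{a,h}) − ½ Σ_{vacant w} V(|w − x_i|)` (carry the site sum of the
origin to `x_i` by the linear isometry of `hcpStacking_homogeneous`, split it over occupied and
vacant sites); all vacant terms are `≤ 0` (`24a/25`-separation), and a bad particle owns a vacant
site within `(1/20 + √2)·a ≤ 1.47` worth `≤ −1/75` (`exists_vacant_site_of_bad_hcp_box`,
`lennardJones_le_of_mem_range`). [folklore] -/
theorem hcpBoxSubsetGap {a h : ℝ} (h47 : 47 / 50 ≤ a) (h1 : a ≤ 1) (hlo : 39 / 50 * a ≤ h)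
    (hhi : h ≤ 17 / 20 * a) {N : ℕ} (x : Fin N → (EuclideanSpace ℝ (Fin 3)))
    (hx : Function.Injective x) (hL : ∀ j, x j ∈ hcpStacking a h) :
    (N : ℝ) * (⨅ Q : PeriodicConfiguration 3, Q.energyPerParticle lennardJones) +
      (1 / 150) * (Nat.card {i : Fin N // ¬ IsTwoShellGood (1 / 20) (47 / 50) 1 x i} : ℝ) ≤
      interactionEnergy lennardJones x := by
  classical
  have ha : 0 < a := by linarith
  have ha0 : a ≠ 0 := ha.ne'
  have h0 : 0 < h := lt_of_lt_of_le (by positivity) hlo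
  have hh0 : h ≠ 0 := h0.ne'
  set L : Set (EuclideanSpace ℝ (Fin 3)) := hcpStacking a h with hLdef
  set P : PeriodicConfiguration 3 := hcpPeriodicConfiguration ha0 hh0 with hPdef
  have hpts : P.points = L := hcpPeriodicConfiguration_points ha0 hh0
  set ea : ℝ := P.energyPerParticle lennardJones with hea_def
  have hea : (⨅ Q : PeriodicConfiguration 3, Q.energyPerParticle lennardJones) ≤ ea := eStar_le P
  -- the site sum at the origin
  have h2ea : (∑' y : {y : (EuclideanSpace ℝ (Fin 3)) // y ∈ L ∧ y ≠ 0},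
      lennardJones ‖(y : (EuclideanSpace ℝ (Fin 3)))‖) = 2 * ea := by
    rw [hea_def, energyPerParticle_hcp_eq_half_tsum ha0 hh0 lennardJones lennardJones_zero,
      tsum_ne_zero_eq_tsum (fun p => lennardJones ‖p‖) (by simp [lennardJones_zero])]
    ring
  have hsum0 : Summable fun y : {y : (EuclideanSpace ℝ (Fin 3)) // y ∈ L ∧ y ≠ 0} =>
      lennardJones ‖(y : (EuclideanSpace ℝ (Fin 3)))‖ := by
    have h := P.summable_lennardJones_dist_three 0
    rw [hpts] at h
    refine h.congr fun y => ?_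
    rw [dist_comm, dist_zero_right]
  -- occupied sites
  set S : Finset (EuclideanSpace ℝ (Fin 3)) := Finset.univ.image x with hS
  have hmemS : ∀ w : (EuclideanSpace ℝ (Fin 3)), w ∈ S ↔ w ∈ Set.range x := fun w => by
    rw [hS]; simp [eq_comm]
  -- the transported, zero-extended site sum around particle `i`
  set s : Fin N → Set (EuclideanSpace ℝ (Fin 3)) := fun i => {w | w ∈ L ∧ w ≠ x i} with hs
  set F : Fin N → (EuclideanSpace ℝ (Fin 3)) → ℝ := fun i w => lennardJones ‖w - x i‖ with hF
  set G : Fin N → (EuclideanSpace ℝ (Fin 3)) → ℝ := fun i => (s i).indicator (F i) with hG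
  -- (A) `∑' G i = 2 ea` and `G i` is summable (vertex-transitivity)
  have hT : ∀ i : Fin N, (∑' w, G i w) = 2 * ea ∧ Summable (G i) := by
    intro i
    have hxi : x i ∈ L := hL i
    obtain ⟨B, hB⟩ := hcpStacking_homogeneous a h hxi
    let T : (s i) ≃ {y : (EuclideanSpace ℝ (Fin 3)) // y ∈ L ∧ y ≠ 0} :=
      { toFun := fun w => ⟨B.symm ((w : (EuclideanSpace ℝ (Fin 3))) - x i), by
          constructor
          · rw [hB, LinearIsometryEquiv.apply_symm_apply, add_sub_cancel]
            exact w.2.1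
          · intro h0'
            have : (w : EuclideanSpace ℝ (Fin 3)) - x i = 0 := by
              have := congrArg B h0'
              rwa [LinearIsometryEquiv.apply_symm_apply, LinearIsometryEquiv.map_zero] at this
            exact w.2.2 (sub_eq_zero.1 this)⟩
        invFun := fun y => ⟨x i + B (y : (EuclideanSpace ℝ (Fin 3))), (hB _).1 y.2.1, fun h0' =>
          y.2.2 (by
            have : B (y : EuclideanSpace ℝ (Fin 3)) = 0 := by
              have h' : x i + B (y : EuclideanSpace ℝ (Fin 3)) = x i + 0 := by rw [add_zero]; exact h0'
              exact add_left_cancel h'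
            exact (LinearIsometryEquiv.map_eq_zero_iff B).1 this)⟩
        left_inv := fun w => by ext; simp
        right_inv := fun y => by ext; simp }
    have hTF : ∀ w : s i, F i w = lennardJones ‖((T w : {y : (EuclideanSpace ℝ (Fin 3)) // y ∈ L ∧ y ≠ 0}) :
        EuclideanSpace ℝ (Fin 3))‖ := by
      intro w
      change lennardJones ‖(w : EuclideanSpace ℝ (Fin 3)) - x i‖ =
        lennardJones ‖B.symm ((w : EuclideanSpace ℝ (Fin 3)) - x i)‖
      rw [LinearIsometryEquiv.norm_map]
    have htsum : (∑' w : s i, F i w) = ∑' y : {y : (EuclideanSpace ℝ (Fin 3)) // y ∈ L ∧ y ≠ 0},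
        lennardJones ‖(y : (EuclideanSpace ℝ (Fin 3)))‖ := by
      rw [← Equiv.tsum_eq T (fun y => lennardJones ‖(y : (EuclideanSpace ℝ (Fin 3)))‖)]
      exact tsum_congr fun w => hTF w
    have hsumT : Summable (F i ∘ (↑) : s i → ℝ) := by
      have h' : (F i ∘ (↑) : s i → ℝ) =
          (fun y : {y : (EuclideanSpace ℝ (Fin 3)) // y ∈ L ∧ y ≠ 0} =>
            lennardJones ‖(y : (EuclideanSpace ℝ (Fin 3)))‖) ∘ T := by
        funext w; exact hTF w
      rw [h']
      exact (T.summable_iff).2 hsum0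
    refine ⟨?_, summable_subtype_iff_indicator.1 hsumT⟩
    rw [hG]
    change (∑' w, (s i).indicator (F i) w) = 2 * ea
    rw [← tsum_subtype (s i) (F i), htsum, h2ea]
  -- (B) the occupied part of `G i` is the finite site sum
  have hocc : ∀ i : Fin N, ∑ w ∈ S, G i w = ∑ j ∈ Finset.univ.erase i, lennardJones (dist (x i) (x j)) := by
    intro i
    rw [hS, Finset.sum_image (fun j _ k _ hjk => hx hjk)]
    rw [← Finset.add_sum_erase Finset.univ (fun j => G i (x j)) (Finset.mem_univ i)]
    have hii : G i (x i) = 0 := by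
      rw [hG]
      exact Set.indicator_of_notMem (fun h => h.2 rfl) _
    rw [hii, zero_add]
    refine Finset.sum_congr rfl fun j hj => ?_
    have hji : j ≠ i := Finset.ne_of_mem_erase hj
    have hmem : x j ∈ s i := ⟨hL j, fun h => hji (hx h)⟩
    rw [hG]
    change (s i).indicator (F i) (x j) = _
    rw [Set.indicator_of_mem hmem, hF]
    change lennardJones ‖x j - x i‖ = lennardJones (dist (x i) (x j))
    rw [← dist_eq_norm, dist_comm]
  -- (C) the vacant part is non-positive, and ≤ −15/768 at a bad particle
  have hGle : ∀ i : Fin N, ∀ w : (EuclideanSpace ℝ (Fin 3)), G i w ≤ 0 := by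
    intro i w
    rw [hG]
    change (s i).indicator (F i) w ≤ 0
    by_cases hw : w ∈ s i
    · rw [Set.indicator_of_mem hw, hF]
      change lennardJones ‖w - x i‖ ≤ 0
      have hd : 24 / 25 * a ≤ dist w (x i) := le_dist_of_mem_hcpStacking_box ha hlo hw.1 (hL i) hw.2
      rw [dist_eq_norm] at hd
      exact lennardJones_nonpos_of_ge_nine_tenths (by linarith)
    · rw [Set.indicator_of_notMem hw]
  have hR0 : ∀ i : Fin N, (∑' w : ↑((↑S : Set (EuclideanSpace ℝ (Fin 3)))ᶜ), G i w) ≤ 0 := fun i =>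
    tsum_nonpos fun w => hGle i w
  have hRbad : ∀ i : Fin N, ¬ IsTwoShellGood (1 / 20) (47 / 50) 1 x i →
      (∑' w : ↑((↑S : Set (EuclideanSpace ℝ (Fin 3)))ᶜ), G i w) ≤ -(1 / 75) := by
    intro i hbad
    obtain ⟨w₀, hw₀L, hvac, hdist⟩ := exists_vacant_site_of_bad_hcp_box h47 h1 hlo hhi hx hL i hbad
    have hw₀S : w₀ ∈ ((↑S : Set (EuclideanSpace ℝ (Fin 3)))ᶜ) := by
      rw [Set.mem_compl_iff, Finset.mem_coe, hmemS]
      exact hvac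
    have hw₀ne : w₀ ≠ x i := fun h => hvac ⟨i, h.symm⟩
    have hw₀s : w₀ ∈ s i := ⟨hw₀L, hw₀ne⟩
    have hGw₀ : G i w₀ ≤ -(1 / 75) := by
      rw [hG]
      change (s i).indicator (F i) w₀ ≤ _
      rw [Set.indicator_of_mem hw₀s, hF]
      change lennardJones ‖w₀ - x i‖ ≤ _
      rw [← dist_eq_norm]
      have hlow : 24 / 25 * a ≤ dist w₀ (x i) :=
        le_dist_of_mem_hcpStacking_box ha hlo hw₀L (hL i) hw₀ne
      have hs2 := sqrt_two_le
      exact lennardJones_le_of_mem_range (by linarith) (by nlinarith)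
    have hg : Summable fun w : ↑((↑S : Set (EuclideanSpace ℝ (Fin 3)))ᶜ) => G i w := (hT i).2.subtype _
    have hle := hg.neg.le_tsum ⟨w₀, hw₀S⟩ (fun w _ => neg_nonneg.2 (hGle i w))
    rw [tsum_neg] at hle
    change -G i w₀ ≤ -(∑' w : ↑((↑S : Set (EuclideanSpace ℝ (Fin 3)))ᶜ), G i w) at hle
    have hle' : (∑' w : ↑((↑S : Set (EuclideanSpace ℝ (Fin 3)))ᶜ), G i w) ≤ G i w₀ := by linarith
    exact hle'.trans hGw₀
  -- (D) the per-particle inequality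
  have hsite : ∀ i : Fin N,
      ea - (1 / 2) * (∑' w : ↑((↑S : Set (EuclideanSpace ℝ (Fin 3)))ᶜ), G i w) =
        (1 / 2 : ℝ) * ∑ j ∈ Finset.univ.erase i, lennardJones (dist (x i) (x j)) := by
    intro i
    have hsplit := (hT i).2.sum_add_tsum_compl (s := S)
    rw [(hT i).1, hocc i] at hsplit
    linarith
  have hpt : ∀ i : Fin N,
      (if ¬ IsTwoShellGood (1 / 20) (47 / 50) 1 x i then (1 / 150 : ℝ) else 0) ≤
        (1 / 2 : ℝ) * (∑ j ∈ Finset.univ.erase i, lennardJones (dist (x i) (x j))) -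
          (⨅ Q : PeriodicConfiguration 3, Q.energyPerParticle lennardJones) := by
    intro i
    rw [← hsite i]
    by_cases hbad : IsTwoShellGood (1 / 20) (47 / 50) 1 x i
    · rw [if_neg (not_not_intro hbad)]
      have := hR0 i
      linarith
    · rw [if_pos hbad]
      have := hRbad i hbad
      linarith
  -- (E) sum over the particles
  have hsum := Finset.sum_le_sum fun i (_ : i ∈ Finset.univ) => hpt i
  rw [sum_halfSite_sub_eStar x] at hsum
  have hcount : ∑ i, (if ¬ IsTwoShellGood (1 / 20) (47 / 50) 1 x i then (1 / 150 : ℝ) else 0) =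
      (1 / 150) * (Nat.card {i : Fin N // ¬ IsTwoShellGood (1 / 20) (47 / 50) 1 x i} : ℝ) := by
    rw [Finset.sum_ite, Finset.sum_const_zero, add_zero, Finset.sum_const, nsmul_eq_mul, mul_comm]
    congr 1
    have e : {i : Fin N // ¬ IsTwoShellGood (1 / 20) (47 / 50) 1 x i} ≃
        {i : Fin N // i ∈ Finset.univ.filter fun i => ¬ IsTwoShellGood (1 / 20) (47 / 50) 1 x i} :=
      Equiv.subtypeEquivRight fun i => by simp
    rw [Nat.card_congr e, Nat.card_eq_fintype_card, Fintype.card_coe]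
  rw [hcount] at hsum
  linarith

/-- **Corollary: `AllBadGap` on relaxed hcp sub-configurations.**  If every particle is bad
(thin plates, needles, porous pieces), then `N · (e* + 1/150) ≤ 𝓔_LJ(x)`. [folklore] -/
theorem allBad_hcpBoxSubsetGap {a h : ℝ} (h47 : 47 / 50 ≤ a) (h1 : a ≤ 1) (hlo : 39 / 50 * a ≤ h)
    (hhi : h ≤ 17 / 20 * a) {N : ℕ}
    (x : Fin N → (EuclideanSpace ℝ (Fin 3))) (hx : Function.Injective x)
    (hL : ∀ j, x j ∈ hcpStacking a h)
    (hbad : ∀ i : Fin N, ¬ IsTwoShellGood (1 / 20) (47 / 50) 1 x i) :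
    (N : ℝ) * ((⨅ Q : PeriodicConfiguration 3, Q.energyPerParticle lennardJones) + 1 / 150) ≤
      interactionEnergy lennardJones x := by
  have hg := hcpBoxSubsetGap h47 h1 hlo hhi x hx hL
  have hcard : (Nat.card {i : Fin N // ¬ IsTwoShellGood (1 / 20) (47 / 50) 1 x i} : ℝ) = N := by
    have e : {i : Fin N // ¬ IsTwoShellGood (1 / 20) (47 / 50) 1 x i} ≃ Fin N :=
      Equiv.subtypeUnivEquiv hbad
    rw [Nat.card_congr e, Nat.card_eq_fintype_card, Fintype.card_fin]
  rw [hcard] at hg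
  linarith

/-- **Isometric form.**  The same bound for every configuration CONGRUENT to a relaxed hcp
sub-configuration: if some isometry `g` of `ℝ³` carries all particles into `hcpStacking a h`
(`a ∈ [47/50, 1]`, `h ∈ [39a/50, 17a/20]`), then `N · e* + (1/150) · #bad ≤ 𝓔_LJ(x)`. [folklore] -/
theorem hcpBoxSubsetGap_of_isometry {a h : ℝ} (h47 : 47 / 50 ≤ a) (h1 : a ≤ 1)
    (hlo : 39 / 50 * a ≤ h) (hhi : h ≤ 17 / 20 * a) {N : ℕ}
    (x : Fin N → (EuclideanSpace ℝ (Fin 3))) (hx : Function.Injective x)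
    (g : (EuclideanSpace ℝ (Fin 3)) ≃ᵢ (EuclideanSpace ℝ (Fin 3)))
    (hL : ∀ j, g (x j) ∈ hcpStacking a h) :
    (N : ℝ) * (⨅ Q : PeriodicConfiguration 3, Q.energyPerParticle lennardJones) +
      (1 / 150) * (Nat.card {i : Fin N // ¬ IsTwoShellGood (1 / 20) (47 / 50) 1 x i} : ℝ) ≤
      interactionEnergy lennardJones x := by
  set y : Fin N → (EuclideanSpace ℝ (Fin 3)) := fun j => g (x j) with hy
  have hyinj : Function.Injective y := fun j k hjk => hx (g.injective hjk)
  have hE : interactionEnergy lennardJones y = interactionEnergy lennardJones x :=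
    interactionEnergy_comp_isometry lennardJones g.isometry x
  have hg := hcpBoxSubsetGap h47 h1 hlo hhi y hyinj hL
  rw [hE] at hg
  have hmono : (Nat.card {i : Fin N // ¬ IsTwoShellGood (1 / 20) (47 / 50) 1 x i} : ℝ) ≤
      (Nat.card {i : Fin N // ¬ IsTwoShellGood (1 / 20) (47 / 50) 1 y i} : ℝ) := by
    have hxy : ∀ i, IsTwoShellGood (1 / 20) (47 / 50) 1 y i → IsTwoShellGood (1 / 20) (47 / 50) 1 x i := by
      intro i hi
      have := hi.map_isometryEquiv g.symm
      simpa [hy] using this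
    exact_mod_cast Nat.card_le_card_of_injective
      (fun b : {i : Fin N // ¬ IsTwoShellGood (1 / 20) (47 / 50) 1 x i} =>
        (⟨b.1, fun hgood => b.2 (hxy b.1 hgood)⟩ : {i : Fin N // ¬ IsTwoShellGood (1 / 20) (47 / 50) 1 y i}))
      (fun b c hbc => Subtype.ext (by simpa using congrArg Subtype.val hbc))
  nlinarith [hmono, hg]

/-! ## §11 Every point of the relaxed hcp stacking is good in the stacking -/

/-- **Every point of the relaxed hcp stacking is `1/20`-good in the stacking** (set form
`IsTwoShellGoodSet`, the predicate of the torus forms of the target and of the hull arguments):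
`a ∈ [47/50, 1]`, `h ∈ [39a/50, 17a/20]`; the witness is the frame and site map of
`hcp_twoShell_sites_box`. [folklore] -/
theorem isTwoShellGoodSet_hcpStacking_box {a h : ℝ} (h47 : 47 / 50 ≤ a) (h1 : a ≤ 1)
    (hlo : 39 / 50 * a ≤ h) (hhi : h ≤ 17 / 20 * a) {p : EuclideanSpace ℝ (Fin 3)}
    (hp : p ∈ hcpStacking a h) : IsTwoShellGoodSet (1 / 20) (47 / 50) 1 (hcpStacking a h) p := by
  have ha : 0 < a := by linarith
  obtain ⟨A, site, hA1, hinj, hA2⟩ := hcp_twoShell_sites_box ha hlo hhi hp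
  refine ⟨a, h47, h1, A, hcpTwoShellPattern, site, Or.inr rfl, ?_, hinj, ?_⟩
  · intro v hv
    obtain ⟨hmem, -, hclose⟩ := hA1 v hv
    exact ⟨hmem, by rw [show (1 / 20 : ℝ) * a = a / 20 by ring]; exact hclose⟩
  · intro y hy hyp hd
    obtain ⟨v, hv, rfl⟩ := hA2 y hy hyp hd
    exact ⟨v, hv, rfl⟩

/-- The same for the ideal stacking (`h² = ⅔a²` lies in the box). [folklore] -/
theorem isTwoShellGoodSet_hcpStacking_ideal {a h : ℝ} (h47 : 47 / 50 ≤ a) (h1 : a ≤ 1)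
    (h0 : 0 < h) (hh : h ^ 2 = 2 / 3 * a ^ 2) {p : EuclideanSpace ℝ (Fin 3)}
    (hp : p ∈ hcpStacking a h) : IsTwoShellGoodSet (1 / 20) (47 / 50) 1 (hcpStacking a h) p := by
  have ha : 0 < a := by linarith
  refine isTwoShellGoodSet_hcpStacking_box h47 h1 ?_ ?_ hp
  · nlinarith
  · nlinarith

/-- **Index form: a particle of a relaxed hcp sub-configuration whose whole `3a/2`-neighbourhood
in the stacking is occupied is `1/20`-good** (user-facing wrapper of
`good_of_sites_occupied_hcp_box`; `a ∈ [47/50, 1]`, `h ∈ [39a/50, 17a/20]`, distinct particles on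
`hcpStacking a h`). [folklore] -/
theorem good_of_neighbourhood_occupied_hcp_box {a h : ℝ} (h47 : 47 / 50 ≤ a) (h1 : a ≤ 1)
    (hlo : 39 / 50 * a ≤ h) (hhi : h ≤ 17 / 20 * a) {N : ℕ} {x : Fin N → EuclideanSpace ℝ (Fin 3)}
    (hx : Function.Injective x) (hL : ∀ j, x j ∈ hcpStacking a h) (i : Fin N)
    (hocc : ∀ w ∈ hcpStacking a h, w ≠ x i → dist w (x i) ≤ 3 / 2 * a → w ∈ Set.range x) :
    IsTwoShellGood (1 / 20) (47 / 50) 1 x i := by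
  have ha : 0 < a := by linarith
  obtain ⟨A, site, hA1, hinj, hA2⟩ := hcp_twoShell_sites_box ha hlo hhi (hL i)
  refine good_of_sites_occupied_hcp_box h47 h1 hx hL i A site
    (fun v hv => ⟨(hA1 v hv).2.1, (hA1 v hv).2.2⟩) hinj hA2 ?_
  intro v hv
  obtain ⟨hmem, hne, hclose⟩ := hA1 v hv
  -- the site lies within `a/20 + ‖a • A v‖ ≤ a/20 + √2·a < 3a/2` of `x i`
  have hnorm : ‖a • A v‖ ≤ Real.sqrt 2 * a := by
    rw [norm_smul, LinearIsometry.norm_map, Real.norm_of_nonneg ha.le]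
    have h2 : (1 : ℝ) ≤ Real.sqrt 2 := Real.one_le_sqrt.mpr (by norm_num)
    rcases norm_of_mem_hcpTwoShellPattern hv with hn | hn
    · rw [hn]; nlinarith
    · rw [hn, mul_comm]
  have htri : dist (site v) (x i) ≤ dist (site v) (x i + a • A v) + dist (x i + a • A v) (x i) :=
    dist_triangle _ _ _
  rw [dist_comm (x i + a • A v) (x i), dist_self_add_right] at htri
  have hs2 := sqrt_two_le
  have hd : dist (site v) (x i) ≤ 3 / 2 * a := by nlinarith
  obtain ⟨j, hj⟩ := hocc _ hmem hne hd
  exact ⟨j, hj⟩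

/-- **Registered sub-goal `stub_hcpBoxSubset` of the crux item** (line `Sketch`, continuation
lead c2): RELAXED HCP LATTICE-SUBSET COERCIVITY — the route's target `CoerciveTwoShellGap`, hence
the line's residual `TightContactGap`, HOLDS with the explicit constant `1/150` and at every
separation on the sub-configurations of `hcpStacking a h`, `a ∈ [47/50, 1]`, `h ∈ [39a/50, 17a/20]`
(vacancies, voids, free surfaces, finite pieces of any shape of the conjectured Lennard-Jones
ground state with its relaxed axial ratio), without any knowledge of `e*`. [folklore] -/
theorem stub_hcpBoxSubset :
    ∀ a h : ℝ, 47 / 50 ≤ a → a ≤ 1 → 39 / 50 * a ≤ h → h ≤ 17 / 20 * a →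
    ∀ (N : ℕ) (x : Fin N → EuclideanSpace ℝ (Fin 3)), Function.Injective x →
      (∀ j : Fin N, x j ∈ hcpStacking a h) →
      (N : ℝ) * (⨅ Q : PeriodicConfiguration 3, Q.energyPerParticle lennardJones) +
        (1 / 150) * (Nat.card {i : Fin N // ¬ IsTwoShellGood (1 / 20) (47 / 50) 1 x i} : ℝ) ≤
        interactionEnergy lennardJones x :=
  fun _ _ h47 h1 hlo hhi _ x hx hL => hcpBoxSubsetGap h47 h1 hlo hhi x hx hL

end Summit.AtomisticToContinuum.Crystallization.Theorems.PhononSlackCertificatesNearFarGlueR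

end
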